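import Mathlib
import Summits.Ventures.PercRepro2.HCov
import Summits.Ventures.PercRepro2.RootLeafUHalf
import Summits.Ventures.PercRepro2.RootLeafUMixK
import Summits.Ventures.PercRepro2.RootLeafUMixKA
import Summits.Ventures.PercRepro2.RootLeafUMixL
import Summits.Ventures.PercRepro2.RootLeafUMixLA
import Summits.Ventures.PercRepro2.RootLeafUMixMax
import Summits.Ventures.PercRepro2.CrossClusterFunctional
import Summits.Ventures.PercRepro2.RootLeafUMixHb

/-!
# (G4-u): THE MIXED-COVARIANCE BOUND WITH `ρ = hbL` ON THE `o ∈ L` SIDE — part 1: the functional `φ_L` and the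
exploration of `K = C(a₂)` (`J₀ = P(T, bL)`, `J ≤ P(T, oL, bL)`) (blind cell PercRepro2, p4 g14; S3 item (aa);
no definitions).  The MIRROR of RootLeafUMixHb with the roles of the roots swapped: the world is
`R = {L avoids {a₂, c}}` (mass `W = D + t`), the explored cluster is `K = C(a₂)`, `g_L(K) = P(b ∈ C(u) in G ∖ K)`,
`hbL = P(u ↔ b)`; the theorem `hbL_delta_add_bracket_nonneg` is part 2, RootLeafUMixHbLThm.
-/

namespace Summit.Ventures.PercRepro2

open UnionCluster CovForm

namespace RootLeafU

namespace MixL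

variable {V : Type*} {E : Type*} [Fintype E] [DecidableEq E] [Fintype V] [DecidableEq V]
  {R : Type*} [Field R] [LinearOrder R] [IsStrictOrderedRing R]

section Phi

variable (p : E → R) (ends : E → Sym2 V) (u c b : V)

omit [Fintype V] [DecidableEq V] [LinearOrder R] [IsStrictOrderedRing R] in
/-- `g(∅) = hb`: with nothing deleted, `P(b ∈ C(a₂) in G ∖ ∅) = P(a₂ ↔ b)`. -/
lemma delClusterProbL_empty_eq :
    delClusterProb p ends u {W : Set V | b ∈ W} (∅ : Set V) = prob p (connEvent ends u b) := by
  unfold delClusterProb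
  congr 1
  ext ω
  simp only [Set.mem_setOf_eq, delConfig_empty_eq_self, mem_cluster, mem_connEvent]

omit [Fintype V] [DecidableEq V] in
/-- `g(L) ≤ hb` for every `L`. -/
lemma delClusterProbL_le_hbL (hp : IsProbVec p) (L : Set V) :
    delClusterProb p ends u {W : Set V | b ∈ W} L ≤ prob p (connEvent ends u b) := by
  rw [← delClusterProbL_empty_eq p ends u b]
  exact delClusterProb_anti p hp ends u (fun _ _ h hb => h hb) (Set.empty_subset L)

omit [Fintype V] [DecidableEq V] in
/-- **`φ` is antitone**: `φ(L) = g(L)` if `c ∈ L`, `hb` if `c ∉ L` (written with indicators). -/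
lemma phiL_antitone (hp : IsProbVec p) :
    Antitone (fun L : Set V =>
      ({W : Set V | c ∈ W}).indicator (delClusterProb p ends u {W : Set V | b ∈ W}) L +
        ({W : Set V | c ∉ W}).indicator (fun _ => prob p (connEvent ends u b)) L) := by
  intro L L' h
  have hg := delClusterProb_anti p hp ends u (𝓥 := {W : Set V | b ∈ W}) (fun _ _ h hb => h hb) h
  have hle := delClusterProbL_le_hbL p ends u b hp L'
  simp only
  by_cases hc : c ∈ L
  · have hc' : c ∈ L' := h hc
    rw [Set.indicator_of_mem (show L ∈ {W : Set V | c ∈ W} from hc),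
      Set.indicator_of_mem (show L' ∈ {W : Set V | c ∈ W} from hc'),
      Set.indicator_of_notMem (show L ∉ {W : Set V | c ∉ W} from fun h' => h' hc),
      Set.indicator_of_notMem (show L' ∉ {W : Set V | c ∉ W} from fun h' => h' hc')]
    linarith
  · rw [Set.indicator_of_notMem (show L ∉ {W : Set V | c ∈ W} from hc),
      Set.indicator_of_mem (show L ∈ {W : Set V | c ∉ W} from hc)]
    by_cases hc' : c ∈ L'
    · rw [Set.indicator_of_mem (show L' ∈ {W : Set V | c ∈ W} from hc'),
        Set.indicator_of_notMem (show L' ∉ {W : Set V | c ∉ W} from fun h' => h' hc')]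
      linarith
    · rw [Set.indicator_of_notMem (show L' ∉ {W : Set V | c ∈ W} from hc'),
        Set.indicator_of_mem (show L' ∈ {W : Set V | c ∉ W} from hc')]

omit [Fintype V] [DecidableEq V] in
/-- `φ ≥ 0`. -/
lemma phiL_nonneg (hp : IsProbVec p) (L : Set V) :
    0 ≤ ({W : Set V | c ∈ W}).indicator (delClusterProb p ends u {W : Set V | b ∈ W}) L +
        ({W : Set V | c ∉ W}).indicator (fun _ => prob p (connEvent ends u b)) L := by
  refine add_nonneg (Set.indicator_apply_nonneg fun _ => ?_) (Set.indicator_apply_nonneg fun _ => ?_)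
  · exact delClusterProb_nonneg p hp ends u _ L
  · exact prob_nonneg hp _

end Phi

section Tower

variable (p : E → R) (ends : E → Sym2 V) (o a₂ c b u : V)

omit [Fintype E] [DecidableEq E] [Fintype V] [DecidableEq V] in
/-- `{u ↔ c} ∩ {a₂ ↔ b} ∩ {u ↮ a₂} = T′ ∩ {b ∈ K}`. -/
lemma T_bL_set_eq :
    clusterInEvent ends a₂ {W : Set V | c ∈ W} ∩ clusterInEvent ends u {W : Set V | b ∈ W} ∩
        avoidAll ends a₂ {u} =
      TEvent ends u a₂ c ∩ connEvent ends u b := by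
  rw [ExploreA3.clusterInEvent_mem_eq, ExploreA3.clusterInEvent_mem_eq, avoidAll_singleton_eq]
  unfold TEvent
  ext ω
  simp only [Set.mem_inter_iff, Set.mem_compl_iff]
  tauto

omit [Fintype E] [DecidableEq E] [Fintype V] [DecidableEq V] in
/-- `{u ↔ c} ∩ {a₂ ↔ b, a₂ ↔ o} ∩ {u ↮ a₂} = T′ ∩ {o ∈ K, b ∈ K}`. -/
lemma T_bL_oL_set_eq :
    clusterInEvent ends a₂ {W : Set V | c ∈ W} ∩
        clusterInEvent ends u ({W : Set V | b ∈ W} ∩ {W : Set V | o ∈ W}) ∩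
        avoidAll ends a₂ {u} =
      TEvent ends u a₂ c ∩ (connEvent ends u o ∩ connEvent ends u b) := by
  rw [ExploreA3.clusterInEvent_mem_eq, ExploreA3.clusterInEvent_mem_inter_eq, avoidAll_singleton_eq]
  unfold TEvent
  ext ω
  simp only [Set.mem_inter_iff, Set.mem_compl_iff]
  tauto

omit [DecidableEq V] [LinearOrder R] [IsStrictOrderedRing R] in
/-- **`J₀ = P(T′, bK)`**: the exploration of `L = C(u)` — `E[1_{c∈L} · g(L) · 1_{u↮a₂}] = P(T′, bK)`. -/
lemma J0L_eq :
    expect p (fun ω => ({W : Set V | c ∈ W}).indicator (1 : Set V → R) (cluster ends ω a₂) *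
        delClusterProb p ends u {W : Set V | b ∈ W} (cluster ends ω a₂) *
        (avoidAll ends a₂ {u}).indicator 1 ω) =
      prob p (TEvent ends u a₂ c ∩ connEvent ends u b) := by
  have h := prob_clusterIn_inter_avoid_eq_expect p ends a₂ u (X := {u}) (by simp)
    {W : Set V | c ∈ W} {W : Set V | b ∈ W}
  rw [T_bL_set_eq ends a₂ c b u] at h
  exact h.symm

omit [DecidableEq V] in
/-- **`J ≤ P(T′, oK, bK)`**: `E[1_{c∈L} · g(L) · 1_{o∈K} · 1_{u↮a₂}] ≤ P(T′, oK, bK)` — the exploration of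
`L` turns `1_{o∈K}` into `g_o(L)`, and `g(L)·g_o(L) ≤ g_{bo}(L)` is Harris in `G ∖ L`. -/
lemma JL_le (hp : IsProbVec p) :
    expect p (fun ω => ({W : Set V | c ∈ W}).indicator (1 : Set V → R) (cluster ends ω a₂) *
        delClusterProb p ends u {W : Set V | b ∈ W} (cluster ends ω a₂) *
        (connEvent ends u o).indicator 1 ω * (avoidAll ends a₂ {u}).indicator 1 ω) ≤
      prob p (TEvent ends u a₂ c ∩ (connEvent ends u o ∩ connEvent ends u b)) := by
  classical
  -- the tower identity with `F₁ = 1_{c∈·} · g` and `Ψ = 1_{o∈·}`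
  have ht : u ∈ ({u} : Finset V) := by simp
  have tower := expect_cross_avoid_eq p ends a₂ u ht
    (fun W => ({W : Set V | c ∈ W}).indicator (1 : Set V → R) W *
      delClusterProb p ends u {W : Set V | b ∈ W} W)
    (({W : Set V | o ∈ W}).indicator (1 : Set V → R))
  have e1 : (fun ω => ({W : Set V | c ∈ W}).indicator (1 : Set V → R) (cluster ends ω a₂) *
      delClusterProb p ends u {W : Set V | b ∈ W} (cluster ends ω a₂) *
      (connEvent ends u o).indicator 1 ω * (avoidAll ends a₂ {u}).indicator 1 ω) =
      (fun ω => (({W : Set V | c ∈ W}).indicator (1 : Set V → R) (cluster ends ω a₂) *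
        delClusterProb p ends u {W : Set V | b ∈ W} (cluster ends ω a₂)) *
        ({W : Set V | o ∈ W}).indicator (1 : Set V → R) (cluster ends ω u) *
        (avoidAll ends a₂ {u}).indicator 1 ω) := by
    funext ω
    rw [MixK.indicator_mem_cluster_eq ends u o ω]
  rw [e1, tower]
  simp only [MixK.delExpect_indicator_eq]
  -- pointwise: `g_b(L) · g_o(L) ≤ g_{bo}(L)`
  have hpt : ∀ ω, ({W : Set V | c ∈ W}).indicator (1 : Set V → R) (cluster ends ω a₂) *
      delClusterProb p ends u {W : Set V | b ∈ W} (cluster ends ω a₂) *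
      delClusterProb p ends u {W : Set V | o ∈ W} (cluster ends ω a₂) *
      (avoidAll ends a₂ {u}).indicator 1 ω ≤
      ({W : Set V | c ∈ W}).indicator (1 : Set V → R) (cluster ends ω a₂) *
      delClusterProb p ends u ({W : Set V | b ∈ W} ∩ {W : Set V | o ∈ W}) (cluster ends ω a₂) *
      (avoidAll ends a₂ {u}).indicator 1 ω := by
    intro ω
    have hH := ExploreA3.delClusterProb_mul_le p hp ends u (𝓤 := {W : Set V | b ∈ W})
      (𝓥 := {W : Set V | o ∈ W}) (fun _ _ h hb => h hb) (fun _ _ h ho => h ho) (cluster ends ω a₂)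
    have h1 : 0 ≤ ({W : Set V | c ∈ W}).indicator (1 : Set V → R) (cluster ends ω a₂) :=
      Set.indicator_apply_nonneg fun _ => zero_le_one
    have h2 : 0 ≤ (avoidAll ends a₂ {u}).indicator (1 : Config E → R) ω :=
      Set.indicator_apply_nonneg fun _ => zero_le_one
    have := mul_le_mul_of_nonneg_right (mul_le_mul_of_nonneg_left hH h1) h2
    linarith [this]
  have hmono : expect p (fun ω => ({W : Set V | c ∈ W}).indicator (1 : Set V → R) (cluster ends ω a₂) *
      delClusterProb p ends u {W : Set V | b ∈ W} (cluster ends ω a₂) *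
      delClusterProb p ends u {W : Set V | o ∈ W} (cluster ends ω a₂) *
      (avoidAll ends a₂ {u}).indicator 1 ω) ≤
      expect p (fun ω => ({W : Set V | c ∈ W}).indicator (1 : Set V → R) (cluster ends ω a₂) *
      delClusterProb p ends u ({W : Set V | b ∈ W} ∩ {W : Set V | o ∈ W}) (cluster ends ω a₂) *
      (avoidAll ends a₂ {u}).indicator 1 ω) := by
    unfold expect
    exact Finset.sum_le_sum fun ω _ => mul_le_mul_of_nonneg_left (hpt ω) (weight_nonneg hp ω)
  refine hmono.trans (le_of_eq ?_)
  have h := prob_clusterIn_inter_avoid_eq_expect p ends a₂ u ht {W : Set V | c ∈ W}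
    ({W : Set V | b ∈ W} ∩ {W : Set V | o ∈ W})
  rw [T_bL_oL_set_eq ends o a₂ c b u] at h
  exact h.symm

end Tower

end MixL

end RootLeafU

end Summit.Ventures.PercRepro2
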